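import Mathlib
import HarnessLib
import Literature.MathematicalPhysics.QuantumLattice.FermiRG.BGM2003Sectors
import Summits.HubbardSuperconductivity.HubbardSuperconductivity.Theorems.KLProgrammeH10TwoPointLimitFrameDispersionHyp
import Summits.HubbardSuperconductivity.HubbardSuperconductivity.Theorems.KLProgrammeH10TwoPointLimitPerturbedChartBounds
import Summits.HubbardSuperconductivity.HubbardSuperconductivity.Theorems.KLProgrammeThinLevelSetDispersionChartBounds

/-!
# Route `KLProgramme` — K3 engine (stmt-HubbardSuperconductivity-20437), stub (b) (ℓ)/(I2)–(I3), located item «ABS-UMK-COUNT»: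
# the POLAR GRAPH CHART PACKAGE of the perturbed Fermi curve, ONE set of constants for the whole family `{δ : |δ| ≤ κ₀, ‖Dδ‖ ≤ κ₁, ‖D²δ‖ ≤ κ₂}`

Cell gate-hubbard-kl, seat p4 g15 (frame-uniform half of the model layer, pen (R142)-range GO «(M3) DispersionHyp/frame dischargers»).  The narrow/target
counts of «ABS-UMK-COUNT» (`AbsUmklappCount.card_narrowStrings_le`, `card_targetStrings_le`) consume a θ⋆-uniform chart package `(s₁, Φ, c_f, A_f, B_f, M₁)`
for the curve's polar chart.  `ThinLevelSet.exists_fermiChart_of_bounds` produces it from a `DispersionHyp` datum with radius floor `c_u`, one bound `M` on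
`|u|, |u′|, |u″|` and a curvature floor `c_κ`; the lineage's δ-UNIFORM shell data for the chart `u₂ θ e := perturbedFermiRadius δ (μ + e) θ`
(`chart_radius_ge`, `chart_radius_bounds`, `chart_curvature_ge`, `dispersionHyp_perturbed`) make these — hence the six chart constants — depend on the band
constants `B` and the sizes `κ₁, κ₂` ONLY:

* **`fermiChart_perturbed_uniform`** — `∃ s₁ Φ c_f A_f B_f M₁` (`0 < s₁`, `0 ≤ M₁`, `0 < Φ`, `0 < c_f ≤ A_f`, `0 ≤ B_f`) such that for EVERY even `δ ∈ C^∞`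
  with `|δ| ≤ κ₀`, `‖Dδ‖ ≤ κ₁`, `‖D²δ‖ ≤ κ₂` and EVERY `μ` with `a + κ₀ + 2e₀ ≤ μ ≤ b − κ₀ − 2e₀`, the chart package holds at every base angle `θ⋆`
  for the curve `p⃗_F = BGM2003.fermiPoint u₂`.

The frame / `FrameOK` corollaries follow as in `…FrameBGM2003SectorCountingUniform` §2–§3 (keyed plumbing, left to the booked sessions).
Everything is PROVED by composition; no definitions, no named facts. [cite: BenfattoGiulianiMastropietro2003, §1.2 (2.8a) and §7.1 (A1.1)–(A1.7)]
[cite: BenfattoGiulianiMastropietro2006, §2.4 Lemma 2.1 (2.40)–(2.41)]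
-/

noncomputable section

namespace Summit.HubbardSuperconductivity.HubbardSuperconductivity.Theorems.PerturbedFermiCurve

set_option linter.dupNamespace false -- summit = problem name (single-conjunct summit), D-0017

open Real Set
open Literature.MathematicalPhysics.QuantumLattice Literature.MathematicalPhysics.QuantumLattice.BandSectorCounting
open Literature.MathematicalPhysics.QuantumLattice.FermiRG Literature.MathematicalPhysics.QuantumLattice.FermiRG.BGM2003
open Summit.HubbardSuperconductivity.HubbardSuperconductivity.Theorems.ThinLevelSet

set_option maxHeartbeats 800000 in -- the explicit constants are large closed terms (positivity side goals on them)
/-- **The polar graph chart package of the perturbed Fermi curve, uniformly over the family.**  See the module docstring.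
[cite: BenfattoGiulianiMastropietro2003, §1.2 (2.8a) and §7.1 (A1.1)–(A1.7)] -/
theorem fermiChart_perturbed_uniform {a b : ℝ} (B : BandBounds a b) {κ₀ κ₁ κ₂ e₀ : ℝ} (he₀ : 0 < e₀)
    (hκ₁0 : 0 ≤ κ₁) (hκ₂0 : 0 ≤ κ₂) (hκ₁D : 2 * κ₁ ≤ B.Dtmin)
    (hconv : B.hmin ≤ 2 * (B.hmin - 4 * (κ₁ * (π * Real.sqrt 2 + 2 * B.smax) / (B.Dtmin - κ₁)) *
        ((B.smax + κ₁ * (π * Real.sqrt 2 + 2 * B.smax) / (B.Dtmin - κ₁)) + B.smax)) -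
        κ₂ * (B.smax + κ₁ * (π * Real.sqrt 2 + 2 * B.smax) / (B.Dtmin - κ₁)) ^ 2) :
    ∃ s₁ Φ cf Af Bf M₁ : ℝ, 0 < s₁ ∧ 0 ≤ M₁ ∧ 0 < Φ ∧ 0 < cf ∧ cf ≤ Af ∧ 0 ≤ Bf ∧
      ∀ (δ : (Fin 2 → ℝ) → ℝ), ContDiff ℝ ((⊤ : ℕ∞) : WithTop ℕ∞) δ → (∀ k, δ (-k) = δ k) →
        (∀ k : Fin 2 → ℝ, |δ k| ≤ κ₀) → (∀ k : Fin 2 → ℝ, ‖fderiv ℝ δ k‖ ≤ κ₁) → (∀ k : Fin 2 → ℝ, ‖fderiv ℝ (fderiv ℝ δ) k‖ ≤ κ₂) →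
        ∀ μ : ℝ, a + κ₀ + 2 * e₀ ≤ μ → μ + κ₀ + 2 * e₀ ≤ b →
        ∀ θs : ℝ, ∃ f f' f'' : ℝ → ℝ, Measurable f ∧
          (∀ φ ∈ Icc (-Φ) Φ,
            f ((fermiPoint (fun ϑ e => perturbedFermiRadius δ (μ + e) ϑ) (θs + φ) -
                fermiPoint (fun ϑ e => perturbedFermiRadius δ (μ + e) ϑ) θs) ⬝ᵥ tdir θs) =
              -((fermiPoint (fun ϑ e => perturbedFermiRadius δ (μ + e) ϑ) (θs + φ) -
                fermiPoint (fun ϑ e => perturbedFermiRadius δ (μ + e) ϑ) θs) ⬝ᵥ dir θs)) ∧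
          (∀ y ∈ Icc (-(s₁ / 4 * Φ)) (s₁ / 4 * Φ), HasDerivAt f (f' y) y ∧ HasDerivAt f' (f'' y) y ∧
            cf ≤ f'' y ∧ f'' y ≤ Af ∧ |f' y| ≤ Bf) ∧
          (∀ φ ∈ Icc (-Φ) Φ, ∀ φ' ∈ Icc (-Φ) Φ,
            s₁ / 2 * |φ - φ'| ≤
              |(fermiPoint (fun ϑ e => perturbedFermiRadius δ (μ + e) ϑ) (θs + φ) -
                  fermiPoint (fun ϑ e => perturbedFermiRadius δ (μ + e) ϑ) θs) ⬝ᵥ tdir θs -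
                (fermiPoint (fun ϑ e => perturbedFermiRadius δ (μ + e) ϑ) (θs + φ') -
                  fermiPoint (fun ϑ e => perturbedFermiRadius δ (μ + e) ϑ) θs) ⬝ᵥ tdir θs| ∧
            |(fermiPoint (fun ϑ e => perturbedFermiRadius δ (μ + e) ϑ) (θs + φ) -
                  fermiPoint (fun ϑ e => perturbedFermiRadius δ (μ + e) ϑ) θs) ⬝ᵥ tdir θs -
                (fermiPoint (fun ϑ e => perturbedFermiRadius δ (μ + e) ϑ) (θs + φ') -
                  fermiPoint (fun ϑ e => perturbedFermiRadius δ (μ + e) ϑ) θs) ⬝ᵥ tdir θs| ≤ M₁ * |φ - φ'|) ∧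
          (fermiPoint (fun ϑ e => perturbedFermiRadius δ (μ + e) ϑ) (θs + 0) -
              fermiPoint (fun ϑ e => perturbedFermiRadius δ (μ + e) ϑ) θs) ⬝ᵥ tdir θs = 0 := by
  have hDt := B.Dtmin_pos; have hum := B.umin_pos; have hsm := B.smax_pos; have hhm := B.hmin_pos; have hπ := Real.pi_pos
  have hκ₁lt : κ₁ < B.Dtmin := by linarith
  have hden : 0 < B.Dtmin - κ₁ := sub_pos.2 hκ₁lt
  -- the shell-uniform constants
  set SE : ℝ := B.smax + κ₁ * (π * Real.sqrt 2 + 2 * B.smax) / (B.Dtmin - κ₁) with hSE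
  have hSE0 : 0 < SE := by rw [hSE]; positivity
  set M : ℝ := π * Real.sqrt 2 + (4 + κ₁) * (π * Real.sqrt 2) / (B.Dtmin - κ₁) +
      ((4 + κ₂) * (B.smax + κ₁ * (π * Real.sqrt 2 + 2 * B.smax) / (B.Dtmin - κ₁)) ^ 2 +
        (8 + 2 * κ₁) * ((4 + κ₁) * (π * Real.sqrt 2) / (B.Dtmin - κ₁)) + (4 + κ₁) * (π * Real.sqrt 2)) / (B.Dtmin - κ₁) with hM
  have hM0 : 0 < M := by rw [hM]; positivity
  set cκ : ℝ := B.umin * B.hmin / ((4 + κ₁) * (2 * (B.smax + κ₁ * (π * Real.sqrt 2 + 2 * B.smax) / (B.Dtmin - κ₁))) ^ 3) with hcκ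
  have hcκ0 : 0 < cκ := by rw [hcκ]; positivity
  set cu : ℝ := B.umin with hcu
  -- the six chart constants
  refine ⟨cu, cu / (8 * M), cκ * cu ^ 3 / (M + M) ^ 3, max (8 * (M ^ 2 + 2 * M ^ 2 + M * M) / cu ^ 3) (cκ * cu ^ 3 / (M + M) ^ 3),
    2 * (M + M) / cu, M + M, hum, by positivity, by positivity, by positivity, le_max_right _ _, by positivity, ?_⟩
  intro δ hδs heven hδ hκ hκ₂ μ hlo hhi θs
  have hδ2 : ContDiff ℝ 2 δ := hδs.of_le (WithTop.coe_le_coe.mpr le_top)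
  have hδ' : ∀ k : Fin 2 → ℝ, (∀ i, |k i| ≤ π) → |δ k| ≤ κ₀ := fun k _ => hδ k
  have hκ' : ∀ k : Fin 2 → ℝ, (∀ i, |k i| ≤ π) → ‖fderiv ℝ δ k‖ ≤ κ₁ := fun k _ => hκ k
  have hκ₂' : ∀ k : Fin 2 → ℝ, (∀ i, |k i| ≤ π) → ‖fderiv ℝ (fderiv ℝ δ) k‖ ≤ κ₂ := fun k _ => hκ₂ k
  have hlo1 : a ≤ μ - κ₀ - e₀ := by linarith
  have hhi1 : μ + κ₀ + e₀ ≤ b := by linarith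
  -- BGM 2003 §1.2 for the chart; radius floor; the bound `M`; the curvature floor
  have hD := dispersionHyp_perturbed B hδs heven hδ' hκ' hκ₂' hκ₁D hconv he₀ hlo hhi
  have hrad := chart_radius_ge B hδ2 hδ' hlo1 hhi1
  have hMb := chart_radius_bounds B hδ2 hδ' hlo1 hhi1 hκ' hκ₁lt hκ₂'
  have hcurv := chart_curvature_ge B hδ2 hδ' hlo1 hhi1 hκ' hκ₁lt hκ₂' hconv
  obtain ⟨f, f', f'', hfm, hval, hder, hlip, hU0⟩ :=
    exists_fermiChart_of_bounds hD hum hcκ0 hrad (fun θ e he => hMb θ e he) (fun θ e he => hcurv θ e he) θs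
  refine ⟨f, f', f'', hfm, hval, fun y hy => ?_, fun φ hφ φ' hφ' => ?_, hU0⟩
  · obtain ⟨h1, h2, h3, h4, h5⟩ := hder y hy
    exact ⟨h1, h2, h3, h4.trans (le_max_left _ _), h5⟩
  · exact hlip φ hφ φ' hφ'

end Summit.HubbardSuperconductivity.HubbardSuperconductivity.Theorems.PerturbedFermiCurve

end
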